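import Mathlib
import HarnessLib
import Summits.Parity.BatemanHorn.Theses.AlmostPrimeZeros
import Summits.Parity.BatemanHorn.Theorems.AlmostPrimeZerosLinearCappedRepulsion

/-!
# Species coupling of the almost-prime zeros: crux corollary and the linear calibration

Line `buchstab-flow-hyperbolicity` of crux stmt-Parity-11291
(`Summit.Parity.BatemanHorn.Theses.AlmostPrimeZeros.SystemZeroRepulsion`), stub `stub_speciesCoupling`.

Let `S_x = Σ_{0 ≤ n ≤ x} X^{s_f(n)} ∈ ℂ[X]` be the almost-prime polynomial of a Bateman–Horn system `f`
(`s_f(n) = Σ_i Σ_{p^v ∥ f_i(n)} min(v,2)`), `T(P) = Σ_ρ ‖1 − ρ‖⁻²` the crux functional (roots of `P` over `ℂ`,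
with multiplicity), `M_y = ∏_{p ≤ y} E_p` the Euler species (`E_p = Σ_{n < p²} X^{s_{f,p}(n)}`,
`s_{f,p}(n) = Σ_i ([p ∣ f_i(n)] + [p² ∣ f_i(n)])`), `R_{x,y} = Σ_{n ≤ x} X^{s_{f,>y}(n)}` the rough polynomial
and `y_A(x) = ⌊exp(log x/(log log x)^A)⌋` the small-prime cut.  The line's stub `SpeciesCoupling` asks, for
every system and every `K > 0`, for `A ≥ 2`, `C`, `x₀` with
`NEAR_K(x) := Σ_{ρ : ‖1−ρ‖ ≤ K log log x} ‖1 − ρ‖⁻² ≤ T(M_{y_A(x)}) + T(R_{x,y_A(x)}) + C` for `x ≥ x₀`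
(the sum over the roots of `S_x`).

Two kernel facts are recorded here (everything PROVED, theorems only):

* `speciesCoupling_of_systemZeroRepulsion`: the crux IMPLIES the stub — the near part is a sub-sum of
  non-negative terms of `T(S_x) ≤ C_f` (`x ≥ 2`), and `T(M)`, `T(R)` are non-negative; take `A = 2`,
  `C = C_f`, `x₀ = 2`.  So the stub is a genuine piece of the crux, not an independent strengthening.
* `speciesCoupling_linear_calibration`: for the calibration system `k = 1`, `f = X` the stub holds
  UNCONDITIONALLY, from the proved rank-5 item `LinearCappedRepulsion`
  (`Summit.Parity.BatemanHorn.Cruxes.LinearCappedRepulsion.JensenStieltjesMajorant.LinearCappedRepulsion_of`):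
  `s_{(X)}(n) = Σ_{p^v ∥ n} min(v,2)` since `X(n) = n`.
-/

noncomputable section

namespace Summit.Parity.BatemanHorn.Cruxes.SystemZeroRepulsion.BuchstabFlowHyperbolicity

open Polynomial

/-- `T(P) = Σ_ρ ‖1 − ρ‖⁻² ≥ 0` for every complex polynomial `P`. -/
private theorem cpl_repulsion_nonneg (P : Polynomial ℂ) :
    0 ≤ (P.roots.map (fun ρ : ℂ => (‖(1 : ℂ) - ρ‖ ^ 2)⁻¹)).sum :=
  Multiset.sum_nonneg fun t ht => by
    obtain ⟨ρ, -, rfl⟩ := Multiset.mem_map.mp ht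
    positivity

/-- A filtered part of `T(P)` is at most `T(P)` (sub-sum of non-negative terms). -/
private theorem cpl_repulsion_filter_le (P : Polynomial ℂ) (q : ℂ → Prop) [DecidablePred q] :
    ((P.roots.filter q).map (fun ρ : ℂ => (‖(1 : ℂ) - ρ‖ ^ 2)⁻¹)).sum ≤
      (P.roots.map (fun ρ : ℂ => (‖(1 : ℂ) - ρ‖ ^ 2)⁻¹)).sum := by
  obtain ⟨u, hu⟩ := Multiset.le_iff_exists_add.mp (Multiset.filter_le q P.roots)
  have hnn : 0 ≤ (u.map (fun ρ : ℂ => (‖(1 : ℂ) - ρ‖ ^ 2)⁻¹)).sum :=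
    Multiset.sum_nonneg fun t ht => by
      obtain ⟨ρ, -, rfl⟩ := Multiset.mem_map.mp ht
      positivity
  calc ((P.roots.filter q).map (fun ρ : ℂ => (‖(1 : ℂ) - ρ‖ ^ 2)⁻¹)).sum
      ≤ ((P.roots.filter q).map (fun ρ : ℂ => (‖(1 : ℂ) - ρ‖ ^ 2)⁻¹)).sum
          + (u.map (fun ρ : ℂ => (‖(1 : ℂ) - ρ‖ ^ 2)⁻¹)).sum := le_add_of_nonneg_right hnn
    _ = (P.roots.map (fun ρ : ℂ => (‖(1 : ℂ) - ρ‖ ^ 2)⁻¹)).sum := by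
          rw [← Multiset.sum_add, ← Multiset.map_add, ← hu]

/-- **The crux implies the species coupling (stub `SpeciesCoupling` of line `buchstab-flow-hyperbolicity`,
fully unfolded).**  GIVEN `SystemZeroRepulsion` (`T(S_x) ≤ C_f` for `x ≥ 2`), for every Bateman–Horn system,
every `K > 0`, with `A = 2`, `C = C_f`, `x₀ = 2`: the near part `Σ_{‖1−ρ‖ ≤ K log log x} ‖1 − ρ‖⁻²` of `T(S_x)`
is at most `T(M_{y_A(x)}) + T(R_{x,y_A(x)}) + C` — the near part is a sub-sum of the non-negative terms of
`T(S_x)`, and the two species functionals are non-negative. -/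
theorem speciesCoupling_of_systemZeroRepulsion :
    Summit.Parity.BatemanHorn.Theses.AlmostPrimeZeros.SystemZeroRepulsion →
    ∀ (k : ℕ) (f : Fin k → Polynomial ℤ), Literature.NumberTheory.Sieve.IsBatemanHornSystem f →
      ∀ K : ℝ, 0 < K → ∃ A : ℝ, 2 ≤ A ∧ ∃ C : ℝ, ∃ x₀ : ℕ, ∀ x : ℕ, x₀ ≤ x →
        (((∑ n ∈ Finset.range (x + 1), (Polynomial.X : Polynomial ℂ) ^
            (∑ i, (((f i).eval (n : ℤ)).toNat.factorization.sum fun _ v => min v 2))).roots.filter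
            fun ρ : ℂ => ‖(1 : ℂ) - ρ‖ ≤ K * Real.log (Real.log (x : ℝ))).map
          (fun ρ : ℂ => (‖(1 : ℂ) - ρ‖ ^ 2)⁻¹)).sum ≤
        ((∏ p ∈ (Finset.range
              (Nat.floor (Real.exp (Real.log (x : ℝ) / Real.log (Real.log (x : ℝ)) ^ A)) + 1)).filter
              Nat.Prime,
            ∑ n ∈ Finset.range (p ^ 2), (Polynomial.X : Polynomial ℂ) ^
              (∑ i, ((if ((p : ℤ) ∣ (f i).eval (n : ℤ)) then 1 else 0) +
                (if ((p : ℤ) ^ 2 ∣ (f i).eval (n : ℤ)) then 1 else 0)))).roots.map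
          (fun ρ : ℂ => (‖(1 : ℂ) - ρ‖ ^ 2)⁻¹)).sum +
        ((∑ n ∈ Finset.range (x + 1), (Polynomial.X : Polynomial ℂ) ^
            (∑ i, (((f i).eval (n : ℤ)).toNat.factorization.sum fun p v =>
              if Nat.floor (Real.exp (Real.log (x : ℝ) / Real.log (Real.log (x : ℝ)) ^ A)) < p
              then min v 2 else 0))).roots.map
          (fun ρ : ℂ => (‖(1 : ℂ) - ρ‖ ^ 2)⁻¹)).sum + C := by
  intro hZ k f hf K _
  obtain ⟨C, hC⟩ := hZ k f hf
  refine ⟨2, le_rfl, C, 2, fun x hx => ?_⟩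
  exact (cpl_repulsion_filter_le _ _).trans ((hC x hx).trans
    (le_add_of_nonneg_left (add_nonneg (cpl_repulsion_nonneg _) (cpl_repulsion_nonneg _))))

/-- **The species coupling holds unconditionally for the calibration system `k = 1`, `f = X` (stub
`SpeciesCoupling` at `![X]`, fully unfolded, no crux hypothesis).**  For every `K > 0`, with `A = 2`, `x₀ = 2`
and `C` the bound of the PROVED rank-5 item `LinearCappedRepulsion` (`T(Σ_{n ≤ x} z^{s(n)}) ≤ C`,
`s(n) = Σ_{p^v ∥ n} min(v,2)`, `x ≥ 2`): the near part of `T(S_x)` is at most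
`T(M_{y_A(x)}) + T(R_{x,y_A(x)}) + C`, because `s_{(X)}(n) = s(n)` (`X(n) = n`), the near part is a sub-sum of
non-negative terms of `T(S_x)`, and `T(M)`, `T(R)` are non-negative. -/
theorem speciesCoupling_linear_calibration :
    ∀ K : ℝ, 0 < K → ∃ A : ℝ, 2 ≤ A ∧ ∃ C : ℝ, ∃ x₀ : ℕ, ∀ x : ℕ, x₀ ≤ x →
      (((∑ n ∈ Finset.range (x + 1), (Polynomial.X : Polynomial ℂ) ^
          (∑ i, (((![(Polynomial.X : Polynomial ℤ)] i).eval (n : ℤ)).toNat.factorization.sum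
            fun _ v => min v 2))).roots.filter
          fun ρ : ℂ => ‖(1 : ℂ) - ρ‖ ≤ K * Real.log (Real.log (x : ℝ))).map
        (fun ρ : ℂ => (‖(1 : ℂ) - ρ‖ ^ 2)⁻¹)).sum ≤
      ((∏ p ∈ (Finset.range
            (Nat.floor (Real.exp (Real.log (x : ℝ) / Real.log (Real.log (x : ℝ)) ^ A)) + 1)).filter
            Nat.Prime,
          ∑ n ∈ Finset.range (p ^ 2), (Polynomial.X : Polynomial ℂ) ^
            (∑ i, ((if ((p : ℤ) ∣ (![(Polynomial.X : Polynomial ℤ)] i).eval (n : ℤ)) then 1 else 0) +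
              (if ((p : ℤ) ^ 2 ∣ (![(Polynomial.X : Polynomial ℤ)] i).eval (n : ℤ)) then 1 else 0)))).roots.map
        (fun ρ : ℂ => (‖(1 : ℂ) - ρ‖ ^ 2)⁻¹)).sum +
      ((∑ n ∈ Finset.range (x + 1), (Polynomial.X : Polynomial ℂ) ^
          (∑ i, (((![(Polynomial.X : Polynomial ℤ)] i).eval (n : ℤ)).toNat.factorization.sum fun p v =>
            if Nat.floor (Real.exp (Real.log (x : ℝ) / Real.log (Real.log (x : ℝ)) ^ A)) < p
            then min v 2 else 0))).roots.map
        (fun ρ : ℂ => (‖(1 : ℂ) - ρ‖ ^ 2)⁻¹)).sum + C := by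
  intro K _
  obtain ⟨C, hC⟩ :=
    Summit.Parity.BatemanHorn.Cruxes.LinearCappedRepulsion.JensenStieltjesMajorant.LinearCappedRepulsion_of
  refine ⟨2, le_rfl, C, 2, fun x hx => ?_⟩
  have key : (∑ n ∈ Finset.range (x + 1), (Polynomial.X : Polynomial ℂ) ^
      (∑ i, (((![(Polynomial.X : Polynomial ℤ)] i).eval (n : ℤ)).toNat.factorization.sum
        fun _ v => min v 2))) =
      ∑ n ∈ Finset.range (x + 1), (Polynomial.X : Polynomial ℂ) ^ (n.factorization.sum fun _ v => min v 2) := by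
    simp
  rw [key]
  exact (cpl_repulsion_filter_le _ _).trans ((hC x hx).trans
    (le_add_of_nonneg_left (add_nonneg (cpl_repulsion_nonneg _) (cpl_repulsion_nonneg _))))

end Summit.Parity.BatemanHorn.Cruxes.SystemZeroRepulsion.BuchstabFlowHyperbolicity

end
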